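import Literature.Analysis.FluidPDE.TaoEnstrophyLocalisation
import HarnessLib

/-!
# `SphereTangentLiouville`, III: the scale-invariant gradient bound from rotated discrete
# self-similarity

Support file for item `stmt-NavierStokesRegularity-1365` (route `CorkscrewDynamo`,
NavierStokesRegularity). After the time shift `t ↦ t − δ` a rotated `λ`-DSS field
(`λ Rᵀ u(λ²t, λRx) = u(t,x)`) satisfies the CONJUGATED covariance
`v(t, x) = λ Rᵀ v(φ t, λ R x)`, `φ t = λ²(t − δ) + δ`, and so does its continuous representative
`V` at every `t < 0` (a.e. equality on every slice, `x ↦ λRx` quasi-measure-preserving, continuity).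
Differentiating, `‖DV(t, x)‖ = λ² ‖DV(φ t, λRx)‖`; iterating from the uniform bound `‖DV‖ ≤ A`
of the KNSS representative gives the SCALE-INVARIANT bound `‖DV(t, x)‖ ≤ λ²δA/(δ − t)`, i.e.
`|∇u(t)| ≲ 1/(−t)` in the original time: the decay of the vorticity as `t → −∞` that feeds the
maximum principle of `CorkscrewDynamoSphereTangentLiouvilleMaxPrinciple.lean`.

* `exists_pow_lt_le` — `yⁿ < x ≤ yⁿ⁺¹` for `x, y > 1`;
* `rdss_of_ae_eq` — the covariance of the representative at every `t < 0`;
* `norm_fderiv_of_rdss` — `‖DV(t,x)‖ = λ²‖DV(φ t, λRx)‖`;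
* `norm_fderiv_iterate_le` — `‖DV(λ^{2k}(t−δ)+δ, ·)‖ ≤ A/λ^{2k}`;
* `norm_fderiv_le_of_rdss` — `‖DV(t, x)‖ ≤ λ²δA/(δ − t)`.
-/

noncomputable section

open MeasureTheory Set Function Filter InnerProductSpace Metric
open scoped RealInnerProductSpace Topology
open Literature.Analysis Literature.Analysis.FluidPDE

set_option linter.dupNamespace false

namespace Summit.NavierStokesRegularity.NavierStokesRegularity.Theorems

/-- For `1 < x` and `1 < y` there is `n` with `yⁿ < x ≤ yⁿ⁺¹`. -/
theorem exists_pow_lt_le {x y : ℝ} (hx : 1 < x) (hy : 1 < y) :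
    ∃ n : ℕ, y ^ n < x ∧ x ≤ y ^ (n + 1) := by
  obtain ⟨m, hm1, hm2⟩ := exists_nat_pow_near hx.le hy
  rcases hm1.lt_or_eq with hlt | heq
  · exact ⟨m, hlt, hm2.le⟩
  · have hm0 : m ≠ 0 := by
      rintro rfl
      rw [pow_zero] at heq
      linarith
    obtain ⟨n, rfl⟩ := Nat.exists_eq_succ_of_ne_zero hm0
    refine ⟨n, ?_, heq.ge⟩
    calc y ^ n < y ^ (n + 1) := pow_lt_pow_right₀ hy (Nat.lt_succ_self n)
      _ = x := heq

/-- **Covariance of the representative at every slice.** If `v(t) = V(t)` a.e. for every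
`t < 0`, `v(t, x) = c Rᵀ v(φ t, c R x)` for all `t, x` with `φ t = c²(t − δ) + δ`
(`0 < c`, `1 ≤ c`, `0 ≤ δ`, so `φ` maps `(−∞,0)` into itself), and the slices `V(t)`, `t < 0`,
are continuous, then `V(t, x) = c Rᵀ V(φ t, c R x)` for all `t < 0` and all `x`. -/
theorem rdss_of_ae_eq
    {v V : ℝ → EuclideanSpace ℝ (Fin 3) → EuclideanSpace ℝ (Fin 3)} {c δ : ℝ}
    {R : EuclideanSpace ℝ (Fin 3) ≃ₗᵢ[ℝ] EuclideanSpace ℝ (Fin 3)}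
    (hc : 1 ≤ c) (hδ : 0 ≤ δ)
    (hvV : ∀ t < 0, v t =ᵐ[volume] V t)
    (hrdss : ∀ t x, v t x = c • R.symm (v (c ^ 2 * (t - δ) + δ) (c • R x)))
    (hVc : ∀ t < 0, Continuous (V t)) :
    ∀ t < 0, ∀ x, V t x = c • R.symm (V (c ^ 2 * (t - δ) + δ) (c • R x)) := by
  intro t ht
  have hc0 : 0 < c := lt_of_lt_of_le one_pos hc
  set t' : ℝ := c ^ 2 * (t - δ) + δ with ht'
  have ht'neg : t' < 0 := by
    have h1 : 1 ≤ c ^ 2 := by nlinarith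
    have : c ^ 2 * (t - δ) ≤ 1 * (t - δ) := by
      have htδ : t - δ ≤ 0 := by linarith
      nlinarith
    linarith
  -- `x ↦ c R x` is quasi-measure-preserving
  have hq : Measure.QuasiMeasurePreserving (fun x : EuclideanSpace ℝ (Fin 3) => c • R x)
      volume volume :=
    (Measure.quasiMeasurePreserving_smul volume hc0.ne').comp R.measurePreserving.quasiMeasurePreserving
  have h1 : (fun x => v t' (c • R x)) =ᵐ[volume] fun x => V t' (c • R x) :=
    hq.ae_eq_comp (hvV t' ht'neg)
  have h2 : V t =ᵐ[volume] fun x => c • R.symm (V t' (c • R x)) := by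
    filter_upwards [hvV t ht, h1] with x hx hx1
    rw [← hx, hrdss t x]
    simp only [← ht'] at hx1 ⊢
    rw [hx1]
  have hcont : Continuous fun x => c • R.symm (V t' (c • R x)) := by
    exact (R.symm.continuous.comp ((hVc t' ht'neg).comp (R.continuous.const_smul c))).const_smul c
  exact fun x => congrFun ((Continuous.ae_eq_iff_eq volume (hVc t ht) hcont).1 h2) x

/-- **`‖DV(t, x)‖ = c² ‖DV(φ t, c R x)‖`** for a family with differentiable slices obeying the
covariance `V(t, x) = c Rᵀ V(φ t, c R x)` (chain rule; `R`, `Rᵀ` are isometries). -/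
theorem norm_fderiv_of_rdss
    {V : ℝ → EuclideanSpace ℝ (Fin 3) → EuclideanSpace ℝ (Fin 3)} {c δ : ℝ}
    {R : EuclideanSpace ℝ (Fin 3) ≃ₗᵢ[ℝ] EuclideanSpace ℝ (Fin 3)}
    (hc : 1 ≤ c) (hδ : 0 ≤ δ)
    (hVd : ∀ t < 0, Differentiable ℝ (V t))
    (hcov : ∀ t < 0, ∀ x, V t x = c • R.symm (V (c ^ 2 * (t - δ) + δ) (c • R x))) :
    ∀ t < 0, ∀ x, ‖fderiv ℝ (V t) x‖ = c ^ 2 * ‖fderiv ℝ (V (c ^ 2 * (t - δ) + δ)) (c • R x)‖ := by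
  intro t ht x
  have hc0 : 0 < c := lt_of_lt_of_le one_pos hc
  set t' : ℝ := c ^ 2 * (t - δ) + δ with ht'
  have ht'neg : t' < 0 := by
    have h1 : 1 ≤ c ^ 2 := by nlinarith
    have : c ^ 2 * (t - δ) ≤ 1 * (t - δ) := by
      have htδ : t - δ ≤ 0 := by linarith
      nlinarith
    linarith
  -- the chain rule
  set T : EuclideanSpace ℝ (Fin 3) →L[ℝ] EuclideanSpace ℝ (Fin 3) :=
    c • (R.toContinuousLinearEquiv : EuclideanSpace ℝ (Fin 3) →L[ℝ] EuclideanSpace ℝ (Fin 3)) with hT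
  have hTx : HasFDerivAt (fun y : EuclideanSpace ℝ (Fin 3) => c • R y) T x := by
    rw [hT]
    exact (R.toContinuousLinearEquiv.hasFDerivAt (x := x)).const_smul c
  set D := fderiv ℝ (V t') (c • R x) with hD
  have hcomp : HasFDerivAt (fun y => V t' (c • R y)) (D.comp T) x :=
    ((hVd t' ht'neg) (c • R x)).hasFDerivAt.comp x hTx
  have hsymm : HasFDerivAt (fun y => R.symm (V t' (c • R y)))
      ((R.symm.toContinuousLinearEquiv : EuclideanSpace ℝ (Fin 3) →L[ℝ] EuclideanSpace ℝ (Fin 3)).comp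
        (D.comp T)) x :=
    (R.symm.toContinuousLinearEquiv.hasFDerivAt).comp x hcomp
  have hall := hsymm.const_smul c
  have hfun : V t = fun y => c • R.symm (V t' (c • R y)) := funext (hcov t ht)
  have hall' : HasFDerivAt (V t) (c • ((R.symm.toContinuousLinearEquiv :
      EuclideanSpace ℝ (Fin 3) →L[ℝ] EuclideanSpace ℝ (Fin 3)).comp (D.comp T))) x := by
    rw [hfun]
    exact hall
  rw [hall'.fderiv, norm_smul, Real.norm_of_nonneg hc0.le]
  -- norms of compositions with isometries
  have e1 : ‖(R.symm.toContinuousLinearEquiv : EuclideanSpace ℝ (Fin 3) →L[ℝ] EuclideanSpace ℝ (Fin 3)).comp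
      (D.comp T)‖ = ‖D.comp T‖ :=
    R.symm.toLinearIsometry.norm_toContinuousLinearMap_comp
  have e2 : D.comp T = c • (D.comp
      (R.toContinuousLinearEquiv : EuclideanSpace ℝ (Fin 3) →L[ℝ] EuclideanSpace ℝ (Fin 3))) := by
    rw [hT, ContinuousLinearMap.comp_smul]
  have e3 : ‖D.comp (R.toContinuousLinearEquiv : EuclideanSpace ℝ (Fin 3) →L[ℝ] EuclideanSpace ℝ (Fin 3))‖ =
      ‖D‖ := ContinuousLinearMap.opNorm_comp_linearIsometryEquiv D R
  rw [e1, e2, norm_smul, Real.norm_of_nonneg hc0.le, e3]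
  ring

/-- **Iterated covariance: `‖DV(c^{2k}(t−δ)+δ, ·)‖ ≤ A/c^{2k}`** from the uniform bound
`‖DV‖ ≤ A` on `(−∞, 0)`. -/
theorem norm_fderiv_iterate_le
    {V : ℝ → EuclideanSpace ℝ (Fin 3) → EuclideanSpace ℝ (Fin 3)} {c δ A : ℝ}
    {R : EuclideanSpace ℝ (Fin 3) ≃ₗᵢ[ℝ] EuclideanSpace ℝ (Fin 3)}
    (hc : 1 ≤ c) (hδ : 0 ≤ δ)
    (hnorm : ∀ t < 0, ∀ x, ‖fderiv ℝ (V t) x‖ = c ^ 2 * ‖fderiv ℝ (V (c ^ 2 * (t - δ) + δ)) (c • R x)‖)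
    (hA : ∀ t < 0, ∀ x, ‖fderiv ℝ (V t) x‖ ≤ A) :
    ∀ k : ℕ, ∀ t < 0, ∀ y, ‖fderiv ℝ (V (c ^ (2 * k) * (t - δ) + δ)) y‖ ≤ A / c ^ (2 * k) := by
  have hc0 : 0 < c := lt_of_lt_of_le one_pos hc
  intro k
  induction k with
  | zero =>
    intro t ht y
    simpa using hA t ht y
  | succ k ih =>
    intro t ht y
    set s : ℝ := c ^ (2 * k) * (t - δ) + δ with hs
    have hsneg : s < 0 := by
      have h1 : 1 ≤ c ^ (2 * k) := one_le_pow₀ hc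
      have : c ^ (2 * k) * (t - δ) ≤ 1 * (t - δ) := by
        have htδ : t - δ ≤ 0 := by linarith
        nlinarith
      linarith
    -- the point `x` with `c R x = y`
    set x : EuclideanSpace ℝ (Fin 3) := R.symm (c⁻¹ • y) with hx
    have hxy : c • R x = y := by
      rw [hx, LinearIsometryEquiv.apply_symm_apply, smul_smul, mul_inv_cancel₀ hc0.ne', one_smul]
    have key := hnorm s hsneg x
    rw [hxy] at key
    have hss : c ^ 2 * (s - δ) + δ = c ^ (2 * (k + 1)) * (t - δ) + δ := by
      rw [hs]; ring
    rw [hss] at key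
    have hk := ih t ht x
    rw [key] at hk
    rw [le_div_iff₀ (by positivity)]
    rw [le_div_iff₀ (by positivity)] at hk
    calc ‖fderiv ℝ (V (c ^ (2 * (k + 1)) * (t - δ) + δ)) y‖ * c ^ (2 * (k + 1))
        = (c ^ 2 * ‖fderiv ℝ (V (c ^ (2 * (k + 1)) * (t - δ) + δ)) y‖) * c ^ (2 * k) := by ring
      _ ≤ A := hk

/-- **The scale-invariant gradient bound `‖DV(t, x)‖ ≤ c²δA/(δ − t)`** (`1 < c`, `0 < δ`). For
`t < 0` choose `n` with `c^{2n} < (δ − t)/δ ≤ c^{2n+2}` and write `t = c^{2n}(t₀ − δ) + δ` with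
`t₀ < 0`; then `‖DV(t)‖ ≤ A/c^{2n} ≤ c²δA/(δ − t)`. -/
theorem norm_fderiv_le_of_rdss
    {V : ℝ → EuclideanSpace ℝ (Fin 3) → EuclideanSpace ℝ (Fin 3)} {c δ A : ℝ}
    {R : EuclideanSpace ℝ (Fin 3) ≃ₗᵢ[ℝ] EuclideanSpace ℝ (Fin 3)}
    (hc : 1 < c) (hδ : 0 < δ)
    (hnorm : ∀ t < 0, ∀ x, ‖fderiv ℝ (V t) x‖ = c ^ 2 * ‖fderiv ℝ (V (c ^ 2 * (t - δ) + δ)) (c • R x)‖)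
    (hA : ∀ t < 0, ∀ x, ‖fderiv ℝ (V t) x‖ ≤ A) :
    ∀ t < 0, ∀ x, ‖fderiv ℝ (V t) x‖ ≤ c ^ 2 * δ * A / (δ - t) := by
  intro τ hτ y
  have hc0 : 0 < c := lt_trans one_pos hc
  have hA0 : 0 ≤ A := (norm_nonneg _).trans (hA τ hτ y)
  set X : ℝ := (δ - τ) / δ with hX
  have hX1 : 1 < X := by rw [hX, lt_div_iff₀ hδ]; linarith
  have hy1 : 1 < c ^ 2 := by nlinarith
  obtain ⟨n, hn1, hn2⟩ := exists_pow_lt_le hX1 hy1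
  rw [← pow_mul] at hn1 hn2
  -- the preimage time
  set t : ℝ := (τ - δ) / c ^ (2 * n) + δ with ht
  have hcn : 0 < c ^ (2 * n) := by positivity
  have htneg : t < 0 := by
    rw [ht, div_add' _ _ _ hcn.ne', div_neg_iff]
    refine Or.inr ⟨?_, hcn⟩
    rw [hX, lt_div_iff₀ hδ] at hn1
    nlinarith
  have htτ : c ^ (2 * n) * (t - δ) + δ = τ := by
    rw [ht]; field_simp; ring
  have key := norm_fderiv_iterate_le hc.le hδ.le hnorm hA n t htneg y
  rw [htτ] at key
  refine key.trans ?_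
  -- `A / c^{2n} ≤ c²δA/(δ − τ)` from `(δ − τ)/δ ≤ c^{2n+2}`
  have hδτ : 0 < δ - τ := by linarith
  rw [div_le_div_iff₀ hcn hδτ]
  rw [hX, div_le_iff₀ hδ, show 2 * (n + 1) = 2 * n + 2 by ring, pow_add] at hn2
  nlinarith [hA0, hn2]

end Summit.NavierStokesRegularity.NavierStokesRegularity.Theorems
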